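import Summits.QuantumFields.YangMills.Theorems.UnitScaleTiltProp7LandauTransversalityMarginSU2Chart
import Summits.QuantumFields.YangMills.Theorems.UnitScaleTiltProp7TwistedSliceGaugeOntoSU2OfQSym
import HarnessLib

/-!
# Route `UnitScaleTilt`, crux K1 child «MinimiserStabilityRegPr» (stmt-QuantumFields-19200), skeleton v10, stub `stub_existenceMinimalOrbit` (EX), route (α) —
# **THE EX DISPLAY'S ROW `hSplit′`∕`hSplitD` FROM ONE COMPLEX PAIRING TEST (+ the printed regularity of the chart point)**: the door
# ★★★`hSplitD_of_pairing` composes this lineage's two halves — (P1) ✓`Prop7TwistedSliceGaugeOntoSU2.exists_su2_slice_tangent_add_gaugeDir_of_QSym_eq_zero` (★w4 g6 ∘ ★px6 ∘ ★w5: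
# every `𝔰𝔲(2)`-valued `ξ ∈ ker QSym(U′)` is `g(ad(−χ(A′)))β′ + 𝒢_{U′}(iN′)`, `β′` an `𝔰𝔲(2)` twisted-slice tangent) and (P2) ✓`Prop7LandauTransversalityMarginSU2Chart.hSplitP2_su2_of_pairing_exp`
# (★w4 g7 ∘ ★w5 g7 ∘ ★px10: `β′ = Dδ` modulo `𝒢_{U′}`, `δ` `𝔰𝔲(2)`-valued in print's linear slice, from the pairing test) — into the `∀ D, HasFDerivAt χ D A′ → ∀ ξ …` BODY of
# ✓`Prop7FibreELOfCritSplitD.fibreEL_of_crit_splitD`'s `hSplitD` ∕ the knit's `hSplit′` (✓`Prop7StubEXOfChartPiecesTwS9`) at `Sl δ := (Q(U₀)δ = 0 ∧ IsLandauPrintS U₀ δ)`, in generic letters.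

Cell `ym3-torus`, width seat `ym-ust-20520-w4` (gen 7).  THEOREMS ONLY (0 `def`, 0 `sorry`).  `--supports stmt-QuantumFields-19200 --as helper`, count-neutral.  YM₃ on T³ is a ladder rung
(R3), not the Clay problem; nothing here claims the stub, the crux, d = 4 or the mass gap.

WHAT IS PROVED (member `F`, `h : n ≤ K`; sorry-free, no definition; ns `…Theorems.Prop7HSplitDOfPairing`):
* ★★★`hSplitD_of_pairing` — in the (D47) window (`U₀ ∈ 𝔘_k(ε₀)`, `10⁹L²e ≤ 1`, `10¹²L³ε₀ ≤ 1`, `‖HY‖ ≤ b‖Y‖`, `H` real, `9C₂ˢbε < 1`, `6ε ≤ e·η`, `Chart47T3twS C₂ˢ ε U₀ H`, `Q(U₀)∘H = id`,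
  `2‖A′‖ < ε`, `A′` skew-Hermitian traceless), with the knit's Landau row `h45L`, the chart point `U′(b) = e^{χ(A′)(b)}U₀(b)` printed-regular (`U′ ∈ 𝔘_k(ε₀′)`, `10⁷L³ε₀′ ≤ 1` — (P1)'s
  displayed input) and the COMPLEX PAIRING TEST in the supplier's letters (`M b := g(ad(−χ(A′)(b)))`, `Gd N b := N(b₋) − e^{χ(A′)(b)}(U₀(b)N(b₊)U₀(b)⋆)e^{−χ(A′)(b)}`): FOR EVERY Fréchet
  derivative `D` of `χ` at `A′` and every skew-Hermitian traceless `ξ` with `QSym(U′)ξ = 0` there are `δ` skew-Hermitian traceless with `Q(U₀)δ = 0`, `IsLandauPrintS U₀ δ` and `N`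
  Hermitian traceless with `ξ(b) = g(ad(−χ(A′)(b)))((Dδ)(b)) + (iN(b₋) − U′(b)·iN(b₊)·U′(b)⋆)` — the `hSplitD` body VERBATIM in generic letters.
INHABITABILITY (★★OWNER RULING g27-№9 (3)): no new displayed row — binders = ✓p652284's ∪ ✓p660927's; the pairing test is the one ✓`Prop7LandauTransversalityPairing.htest_of_suppliers`
delivers (plan v2: (hP) R2a′-tower ∕ ROW-B ∕ (H-Z), (hS) R2e-M ✓ ∕ R2t ∕ R2q″); `hreg′` is (P1)'s displayed input (the chart point's printed regularity, the knit's `hSize19′` neighbourhood).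
HONEST SCOPE.  A composition of landed theorems; the pairing test and `hreg′` are HYPOTHESES; nothing of EX, the crux, N06(d = 3) or the gap is proved or claimed.

References: T. Bałaban, CMP 102 (1985) 277–309 [Balaban1985Variational] ((44)–(51) pp.285–286, (82)–(83) p.290, Prop. 3 p.289); CMP 98 (1985) 17–51 [Balaban1985Averaging] ((11) p.19,
(32)–(34) pp.22–23, (89)–(92) p.31, (97) p.32); CMP 99 (1985) 389–434 [Balaban1985BackgroundPropagators] ((3.3) p.391, (3.13)–(3.15) p.393, (3.20)–(3.23) p.394, (3.115) p.418);
CMP 99 (1985) 75–102 [Balaban1985RegularSpaces] (Sect. D pp.89–95).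
-/

set_option autoImplicit false

noncomputable section

open scoped InnerProductSpace Matrix.Norms.L2Operator Matrix
open Filter Metric NormedSpace

namespace Summit.QuantumFields.YangMills.Theorems.Prop7HSplitDOfPairing

open Literature.Analysis.Calculus.ExpDifferential (ad gSer)
open Literature.MathematicalPhysics.QuantumFieldTheory.Balaban1983to89
open Literature.MathematicalPhysics.QuantumFieldTheory.Balaban1983to89.T3ContinuumYM3Torus
open T3PrintedRegularMinimiser (RegPr)
open T3SectALandauChart (eta eta_pos)
open B11Prop3Model (Dfix)
open B11Eq103H1Complex (SiteL2K BondL2K)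
open Summit.QuantumFields.YangMills.Theorems.Prop7SectET3Transport (periodsT3)
open Summit.QuantumFields.YangMills.Theorems.Prop7SymAvgTwSym (logChartTwS QTwS CmapTwS Chart47T3twS)
open Summit.QuantumFields.YangMills.Theorems.Prop7SymAvgGL (QSym)
open Summit.QuantumFields.YangMills.Theorems.Prop7SectET3HilbertLetters (W₂ toL2 toL2S DL2 covLapSite)
open Summit.QuantumFields.YangMills.Theorems.Prop7SectET3GaugeProjector (NS)
open Summit.QuantumFields.YangMills.Theorems.Prop7SPrint (IsLandauPrintS)
open Summit.QuantumFields.YangMills.Theorems.Prop7TwistedSliceGaugeOntoSU2 (exists_su2_slice_tangent_add_gaugeDir_of_QSym_eq_zero)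
open Summit.QuantumFields.YangMills.Theorems.Prop7LandauTransversalityMarginSU2Chart (chartPoint_su2_norm hSplitP2_su2_of_pairing_exp)

variable (F : T3Family) {n K : ℕ} (h : n ≤ K)

/-- ★★★ **`hSplitD` FROM THE COMPLEX PAIRING TEST.**  In the (D47) window with `H` real, `h45L`, `A′` skew-Hermitian traceless (`2‖A′‖ < ε`), the chart point `U′ = e^{χ(A′)}U₀ ∈ 𝔘_k(ε₀′)`
(`10⁷L³ε₀′ ≤ 1`) and the complex pairing test in the supplier's letters: for every Fréchet derivative `D` of `χ` at `A′`, every skew-Hermitian traceless `ξ` with `QSym(U′)ξ = 0` is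
`ξ(b) = g(ad(−χ(A′)(b)))((Dδ)(b)) + (iN(b₋) − U′(b)·iN(b₊)·U′(b)⋆)` with `δ` skew-Hermitian traceless, `Q(U₀)δ = 0`, `IsLandauPrintS U₀ δ`, `N` Hermitian traceless.  Proof: (P1)
✓`exists_su2_slice_tangent_add_gaugeDir_of_QSym_eq_zero` gives `ξ = g(ad(−χA′))β′ + 𝒢_{U′}(iN′)` with `β′` an `𝔰𝔲(2)` twisted-slice tangent; (P2) ✓`hSplitP2_su2_of_pairing_exp` gives
`g(ad(−χA′))β′ = g(ad(−χA′))(Dδ) + 𝒢_{U′}(iN₂)`; `N := N₂ + N′`.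
[cite: Balaban1985Variational, (44)–(51) pp.285–286, (82)–(83) p.290, Prop. 3 p.289; Balaban1985Averaging, (11) p.19, (32)–(34) pp.22–23, (97) p.32; Balaban1985BackgroundPropagators, (3.3) p.391, (3.13)–(3.15) p.393, (3.20)–(3.23) p.394; Balaban1985RegularSpaces, Sect. D pp.89–95] -/
theorem hSplitD_of_pairing [Fact (0 < (F.L : ℝ))] [Fact (0 < ((F.L : ℝ)⁻¹) ^ (K - n))] {c₀ cB : ℝ} [Fact (0 < c₀)] [Fact (0 < cB)]
    {ε₀ ε₀' e b ε : ℝ} (hε₀ : 0 < ε₀) (he : 0 < e) (hWe : 10 ^ 9 * (F.L : ℝ) ^ 2 * e ≤ 1) (hWε : 10 ^ 12 * (F.L : ℝ) ^ 3 * ε₀ ≤ 1)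
    (hε₀' : 0 < ε₀') (hε' : 10 ^ 7 * (F.L : ℝ) ^ 3 * ε₀' ≤ 1)
    (U₀ : GaugeField (F.P K) 0 (Matrix.specialUnitaryGroup (Fin 2) ℂ)) (hreg : RegPr F n K ε₀ U₀)
    {H : (PBond (F.P n) 0 → Matrix (Fin 2) (Fin 2) ℂ) →ₗ[ℂ] (PBond (F.P K) 0 → Matrix (Fin 2) (Fin 2) ℂ)} (hb : 0 ≤ b) (hHop : ∀ Y, ‖H Y‖ ≤ b * ‖Y‖)
    (hHR : ∀ Y : PBond (F.P n) 0 → Matrix (Fin 2) (Fin 2) ℂ, (∀ c, star (Y c) = -Y c ∧ (Y c).trace = 0) → ∀ b', star (H Y b') = -H Y b' ∧ (H Y b').trace = 0)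
    (hq : 9 * (40 * (2 * (3 * (2 * e + 2700 * (F.L : ℝ) * ε₀))) / (e * eta F n K) ^ 2) * b * ε < 1) (hRε : 6 * ε ≤ e * eta F n K)
    (h47 : Chart47T3twS F n K h (40 * (2 * (3 * (2 * e + 2700 * (F.L : ℝ) * ε₀))) / (e * eta F n K) ^ 2) ε U₀ H) (hQH : ∀ X, QTwS F n K h U₀ (H X) = X)
    (h45L : ∀ Y, IsLandauPrintS F n K h c₀ cB U₀ (H Y))
    {A' : PBond (F.P K) 0 → Matrix (Fin 2) (Fin 2) ℂ} (hA' : 2 * ‖A'‖ < ε) (hA'R : ∀ b', star (A' b') = -A' b' ∧ (A' b').trace = 0)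
    (U' : GaugeField (F.P K) 0 (Matrix.specialUnitaryGroup (Fin 2) ℂ)) (hreg' : RegPr F n K ε₀' U')
    (hU' : ∀ b, ((U' b : Matrix.specialUnitaryGroup (Fin 2) ℂ) : Matrix (Fin 2) (Fin 2) ℂ) = exp ((A' - H (Dfix (CmapTwS F n K h U₀) H (40 * (2 * (3 * (2 * e + 2700 * (F.L : ℝ) * ε₀))) / (e * eta F n K) ^ 2) A')) b) * ((U₀ b : Matrix.specialUnitaryGroup (Fin 2) ℂ) : Matrix (Fin 2) (Fin 2) ℂ))
    (htest : ∀ l : Site (F.P K) 0 → Matrix (Fin 2) (Fin 2) ℂ, toL2S F K c₀ l ∈ NS F n K h c₀ cB U₀ →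
      covLapSite F n K c₀ U₀ (toL2S F K c₀ l) ≠ 0 →
      ∃ (N'' : Site (F.P K) 0 → Matrix (Fin 2) (Fin 2) ℂ) (w : PBond (F.P K) 0 → Matrix (Fin 2) (Fin 2) ℂ),
        (∀ b, gSer ℂ (ad ℂ (-(A' - H (Dfix (CmapTwS F n K h U₀) H (40 * (2 * (3 * (2 * e + 2700 * (F.L : ℝ) * ε₀))) / (e * eta F n K) ^ 2) A')) b)) (w b) =
          N'' b.src - exp ((A' - H (Dfix (CmapTwS F n K h U₀) H (40 * (2 * (3 * (2 * e + 2700 * (F.L : ℝ) * ε₀))) / (e * eta F n K) ^ 2) A')) b) * (((U₀ b : Matrix.specialUnitaryGroup (Fin 2) ℂ) : Matrix (Fin 2) (Fin 2) ℂ) * N'' b.tgt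
            * star ((U₀ b : Matrix.specialUnitaryGroup (Fin 2) ℂ) : Matrix (Fin 2) (Fin 2) ℂ)) * exp (-(A' - H (Dfix (CmapTwS F n K h U₀) H (40 * (2 * (3 * (2 * e + 2700 * (F.L : ℝ) * ε₀))) / (e * eta F n K) ^ 2) A')) b)) ∧
        fderiv ℂ (logChartTwS F n K h U₀) (A' - H (Dfix (CmapTwS F n K h U₀) H (40 * (2 * (3 * (2 * e + 2700 * (F.L : ℝ) * ε₀))) / (e * eta F n K) ^ 2) A')) w = 0 ∧
        ⟪toL2 F K c₀ w, DL2 F n K c₀ U₀ (covLapSite F n K c₀ U₀ (toL2S F K c₀ l))⟫_ℂ ≠ 0) :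
    ∀ D : (PBond (F.P K) 0 → Matrix (Fin 2) (Fin 2) ℂ) →L[ℂ] (PBond (F.P K) 0 → Matrix (Fin 2) (Fin 2) ℂ),
      HasFDerivAt (fun A : PBond (F.P K) 0 → Matrix (Fin 2) (Fin 2) ℂ => A - H (Dfix (CmapTwS F n K h U₀) H (40 * (2 * (3 * (2 * e + 2700 * (F.L : ℝ) * ε₀))) / (e * eta F n K) ^ 2) A)) D A' →
      ∀ ξ : PBond (F.P K) 0 → Matrix (Fin 2) (Fin 2) ℂ, (∀ b', star (ξ b') = -ξ b' ∧ (ξ b').trace = 0) →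
      QSym F n K h U' ξ = 0 →
      ∃ δ : PBond (F.P K) 0 → Matrix (Fin 2) (Fin 2) ℂ, (∀ b', star (δ b') = -δ b' ∧ (δ b').trace = 0) ∧
        (QTwS F n K h U₀ δ = 0 ∧ IsLandauPrintS F n K h c₀ cB U₀ δ) ∧
        ∃ N : Site (F.P K) 0 → Matrix (Fin 2) (Fin 2) ℂ, (∀ x, (N x).IsHermitian ∧ (N x).trace = 0) ∧
          ∀ b' : PBond (F.P K) 0, ξ b' = gSer ℂ (ad ℂ (-(A' - H (Dfix (CmapTwS F n K h U₀) H (40 * (2 * (3 * (2 * e + 2700 * (F.L : ℝ) * ε₀))) / (e * eta F n K) ^ 2) A')) b')) ((D δ) b')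
            + (Complex.I • N b'.src - ((U' b' : Matrix.specialUnitaryGroup (Fin 2) ℂ) : Matrix (Fin 2) (Fin 2) ℂ) * (Complex.I • N b'.tgt) * star ((U' b' : Matrix.specialUnitaryGroup (Fin 2) ℂ) : Matrix (Fin 2) (Fin 2) ℂ)) := by
  intro D hD ξ hξR hξ
  have hA'1 : ‖A'‖ < ε := by linarith [norm_nonneg A']
  obtain ⟨hA₁e, hA₁R, -⟩ := chartPoint_su2_norm F h hε₀ he hWe hWε U₀ hreg hb hHop hHR hq hRε h47 hA'1 hA'R
  -- (P1): `ξ = g(ad(−χA′))β′ + 𝒢_{U′}(iN′)`, `β′` an 𝔰𝔲(2) twisted-slice tangent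
  obtain ⟨β', hβ'R, hβ', N', hN'R, hξeq⟩ := exists_su2_slice_tangent_add_gaugeDir_of_QSym_eq_zero F h hε₀ he hWe hWε hε₀' hε' U₀ U' hreg hreg' _ hA₁e hA₁R hU' ξ hξR hξ
  -- (P2): `g(ad(−χA′))β′ = g(ad(−χA′))(Dδ) + 𝒢_{U′}(iN₂)`
  obtain ⟨δ, hδR, hQδ, hLδ, N₂, hN₂R, hsplit⟩ :=
    hSplitP2_su2_of_pairing_exp F h hε₀ he hWe hWε U₀ hreg hb hHop hHR hq hRε h47 hQH h45L hA' hA'R hD U' hU' htest β' hβ'R hβ'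
  refine ⟨δ, hδR, ⟨hQδ, hLδ⟩, fun x => N₂ x + N' x, fun x => ⟨(hN₂R x).1.add (hN'R x).1, by rw [Matrix.trace_add, (hN₂R x).2, (hN'R x).2, add_zero]⟩, fun b' => ?_⟩
  rw [hξeq b', hsplit b', smul_add, smul_add, Matrix.mul_add, Matrix.add_mul, add_assoc]
  congr 1
  abel

end Summit.QuantumFields.YangMills.Theorems.Prop7HSplitDOfPairing

end
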